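import Literature.Probability.LatticeModels.EdgeKilledBeurling
import Literature.Probability.LatticeModels.KilledWalkGreen
import Literature.Probability.LatticeModels.WeakBeurlingHoleFree
import HarnessLib

/-!
# `G_Λ(·, c) ≤ C₁ / c_*` off the pole box, for the edge-killed walk near `∂D`
(line `symplectic-fermion-anchor`, crux `SAWLoopFugacityFlow.AvoidanceLimit`,
stmt-CriticalPhenomena-10649; stub `killedRegionGreen_le_of_frontier_mem_box`)

Chelkak 2016, Lemma 2.15 (`G_Ω ≤ const` off a neighbourhood of the pole, uniformly in the simply
connected `Ω`), for the EDGE-killed walk `Gr = discreteDomainGraph D δ` of a Jordan domain `D` in a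
finite region `Λ ⊆ ℤ²`, at a pole `c` which sees a boundary point `p ∈ ∂D` in the open box of
radius `12k` about it: `killedRegionGreen Gr Λ w c ≤ C₁ / maneuverConst` for every `w` outside the
box of radius `12k - 2`, where `C₁` is any bound for the FREE Green function of the box
`mW c k = [c ± 48k]²` off the box of radius `12k - 2` (the neighbouring stub `killedRegionGreen_mW_le`).

Proof. (a) `greenSC_le_of_layer_le`: the maximum principle on `Λ ∖ [c ± (n+1)]²` bounds
`G = G_Λ(·, c)` off `[c ± n]²` by its maximum `M` on the layer `Λ ∩ [c ± (n+1)]² ∖ [c ± n]²`.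
(b) `greenSC_layer_le`: on `Λ ∩ W`, `W = mW c k`, the difference `G - G_{Λ ∩ W}(·, c)` is
killed-harmonic (pole included) with exit values `≤ M` off `W` and `0` off `Λ`, so it is at most
`M · edgeSurvive Gr W ≤ M (1 - c_*)` on the start box `mB c k` (one-annulus weak Beurling for the
edge-killed walk, `JordanDomain.edgeKilled_survive_le`), while `G_{Λ ∩ W} ≤ G^{free}_W ≤ C₁` there
(monotonicity in the region and in the graph). (c) At a maximiser on the layer,
`M ≤ C₁ + (1 - c_*) M`, i.e. `M ≤ C₁ / c_*`.

Source: D. Chelkak, *Robust discrete complex analysis: a toolbox*, Ann. Probab. 44 (2016),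
Lemma 2.15 [Chelkak2016]. No definitions.
-/

noncomputable section

open scoped BigOperators Classical
open Finset Literature.Probability.RandomPlanarGeometry Literature.Probability.LatticeModels
open Literature.Probability.LatticeModels.WeakBeurling (sqBox sqBox_mono mem_sqBox)

namespace Summit.CriticalPhenomena.SAWScalingLimit.Theorems.AvoidanceLimit.Anchor

/-- **Outer maximum principle for the Green column.** For a finite region `Λ`, a pole `c`, a radius
`n ≥ 0` and `M ≥ 0`: if `G_Λ(z, c) ≤ M` at every `z ∈ Λ` of the layer `[c ± (n+1)]² ∖ [c ± n]²`, then
`G_Λ(w, c) ≤ M` at every `w ∉ [c ± n]²` (the Green column is killed-harmonic on `Λ ∖ [c ± (n+1)]²`,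
vanishes off `Λ`, and the exit points of that region inside `Λ` lie on the layer). [folklore] -/
theorem greenSC_le_of_layer_le {Gr : SimpleGraph (Site 2)} {Λ : Set (Site 2)} (hΛ : Λ.Finite)
    (c : Site 2) {n : ℤ} (hn : 0 ≤ n) {M : ℝ} (hM0 : 0 ≤ M)
    (hM : ∀ z ∈ Λ, z ∉ sqBox c n → z ∈ sqBox c (n + 1) → killedRegionGreen Gr Λ z c ≤ M) :
    ∀ w : Site 2, w ∉ sqBox c n → killedRegionGreen Gr Λ w c ≤ M := by
  have hRfin : (Λ \ sqBox c (n + 1)).Finite := hΛ.subset fun z hz => hz.1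
  have hcbox : c ∈ sqBox c (n + 1) := by
    rw [mem_sqBox, sub_self, sub_self, abs_zero]
    constructor <;> linarith
  have hsub : Λ \ sqBox c (n + 1) ⊆ Λ \ {c} := fun z hz =>
    ⟨hz.1, fun h => hz.2 (by rw [Set.mem_singleton_iff.1 h]; exact hcbox)⟩
  have hharm : IsKilledHarmonicOn Gr (fun w => killedRegionGreen Gr Λ w c) (Λ \ sqBox c (n + 1)) :=
    (killedRegionGreen_harmonicOn hΛ c).mono hsub
  -- the exit points of the outer region inside `Λ` lie on the layer
  have hbd : ∀ w ∈ killedOuterBoundary Gr (Λ \ sqBox c (n + 1)), killedRegionGreen Gr Λ w c ≤ M := by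
    rintro w ⟨hwR, v, hv, e, rfl, -⟩
    by_cases hwΛ : v + SRW.stepVec e ∈ Λ
    · have hwbox : v + SRW.stepVec e ∈ sqBox c (n + 1) := by
        by_contra h
        exact hwR ⟨hwΛ, h⟩
      refine hM _ hwΛ (fun h => hv.2 ?_) hwbox
      have he0 := SRW.abs_stepVec_apply_le e 0
      have he1 := SRW.abs_stepVec_apply_le e 1
      rw [mem_sqBox] at h ⊢
      simp only [Pi.add_apply] at h
      rw [abs_le, abs_le] at h ⊢
      rw [abs_le] at he0 he1
      constructor <;> constructor <;> omega
    · rw [killedRegionGreen_of_not_mem_left Λ hwΛ]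
      exact hM0
  have hin := hharm.le_of_forall_boundary_le hRfin hM0 hbd
  intro w hw
  by_cases hwΛ : w ∈ Λ
  · by_cases hwbox : w ∈ sqBox c (n + 1)
    · exact hM w hwΛ hw hwbox
    · exact hin w ⟨hwΛ, hwbox⟩
  · rw [killedRegionGreen_of_not_mem_left Λ hwΛ]
    exact hM0

/-- **The one-box step** (Chelkak 2016, proof of Lemma 2.15, for the edge-killed walk). Let
`Gr = discreteDomainGraph D δ`, `p ∈ ∂D` in the open box of radius `12k` about `c`, `Λ` finite with
`c ∈ Λ`, and suppose `G_Λ(·, c) ≤ M` (`M ≥ 0`) off the box `[c ± (12k-2)]²` and the free Green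
function of `W = mW c k` is `≤ C₁` there. Then at every `z ∈ Λ ∩ mB c k` off that box,
`G_Λ(z, c) ≤ C₁ + (1 - c_*) M`: `G_Λ - G_{Λ ∩ W}` is killed-harmonic on `Λ ∩ W` and dominated on its
exit set by `M · edgeSurvive Gr W`, which is `≤ M (1 - c_*)` on `mB c k`
(`JordanDomain.edgeKilled_survive_le`), and `G_{Λ ∩ W} ≤ G^{ℤ²}_W ≤ C₁`. [cite: Chelkak2016, Lemma 2.15] -/
theorem greenSC_layer_le (C₁ : ℝ)
    (hC : ∀ (c : Site 2) (k : ℕ), 0 < k → ∀ w : Site 2, w ∉ WeakBeurling.sqBox c (12 * k - 2) →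
      killedRegionGreen (zdGraph 2) (mW c k) w c ≤ C₁)
    (D : JordanDomain) {δ : ℝ} (hδ : 0 < δ) {p : ℂ} (hp : p ∈ frontier D.carrier) {c : Site 2} {k : ℕ}
    (hk : 0 < k) (hp0 : |p.re / δ - c 0| < 12 * k) (hp1 : |p.im / δ - c 1| < 12 * k)
    {Λ : Set (Site 2)} (hΛ : Λ.Finite) (hcΛ : c ∈ Λ) {M : ℝ} (hM0 : 0 ≤ M)
    (hM : ∀ w : Site 2, w ∉ sqBox c (12 * k - 2) →
      killedRegionGreen (discreteDomainGraph D.carrier δ) Λ w c ≤ M) :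
    ∀ z ∈ Λ, z ∈ mB c k → z ∉ sqBox c (12 * k - 2) →
      killedRegionGreen (discreteDomainGraph D.carrier δ) Λ z c ≤ C₁ + (1 - maneuverConst) * M := by
  intro z hzΛ hzB hz2
  set Gr := discreteDomainGraph D.carrier δ with hGr
  have hGle : Gr ≤ zdGraph 2 :=
    (discreteDomainGraph_le_meshGraph D.carrier δ).trans (meshGraph_le_zdGraph D.carrier δ)
  have hWfin : (mW c k).Finite := mW_finite c k
  have hSfin : (Λ ∩ mW c k).Finite := hΛ.subset Set.inter_subset_left
  have hcW : c ∈ mW c k := by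
    simp only [mW, Set.mem_setOf_eq, sub_self, abs_zero]
    constructor <;> positivity
  have hcS : c ∈ Λ ∩ mW c k := ⟨hcΛ, hcW⟩
  -- `G_Λ - G_{Λ ∩ W}` is killed-harmonic on `Λ ∩ W`, pole included
  have hF : IsKilledHarmonicOn Gr
      ((fun w => killedRegionGreen Gr Λ w c) - fun w => killedRegionGreen Gr (Λ ∩ mW c k) w c)
      (Λ ∩ mW c k) := by
    intro v hv
    rw [killedAvg_sub, Pi.sub_apply]
    have h1 := killedAvg_killedRegionGreen_sub (Gr := Gr) hΛ hcΛ v hv.1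
    have h2 := killedAvg_killedRegionGreen_sub (Gr := Gr) hSfin hcS v hv
    linarith
  -- the comparison function `M · survive`
  have hsurv : IsKilledHarmonicOn Gr (fun w => M * edgeSurvive Gr (mW c k) w) (Λ ∩ mW c k) := by
    have h : IsKilledHarmonicOn Gr (edgeSurvive Gr (mW c k)) (mW c k) := killedHarmExt_harmonicOn hWfin _
    exact (h.mono Set.inter_subset_right).const_mul M
  have hbd : ∀ w ∈ killedOuterBoundary Gr (Λ ∩ mW c k),
      ((fun w => killedRegionGreen Gr Λ w c) - fun w => killedRegionGreen Gr (Λ ∩ mW c k) w c) w ≤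
        M * edgeSurvive Gr (mW c k) w := by
    intro w hw
    have hwS : w ∉ Λ ∩ mW c k := hw.1
    rw [Pi.sub_apply, killedRegionGreen_of_not_mem_left _ hwS, sub_zero]
    by_cases hwW : w ∈ mW c k
    · have hwΛ : w ∉ Λ := fun h => hwS ⟨h, hwW⟩
      rw [killedRegionGreen_of_not_mem_left Λ hwΛ]
      exact mul_nonneg hM0 (edgeSurvive_mem_Icc hWfin w).1
    · rw [edgeSurvive_of_not_mem hwW, mul_one]
      refine hM w fun h => hwW ?_
      rw [mW_eq_sqBox]
      exact sqBox_mono c (by omega) h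
  have key := le_of_killedSub_killedSuper_of_boundary hSfin hF.subharmonicOn hsurv.superharmonicOn hbd
    z ⟨hzΛ, mB_subset_mW hzB⟩
  rw [Pi.sub_apply] at key
  -- the two bounds at `z`
  have h1 : edgeSurvive Gr (mW c k) z ≤ 1 - maneuverConst := D.edgeKilled_survive_le hδ hk hp hp0 hp1 hzB
  have h2 : killedRegionGreen Gr (Λ ∩ mW c k) z c ≤ C₁ :=
    calc killedRegionGreen Gr (Λ ∩ mW c k) z c ≤ killedRegionGreen Gr (mW c k) z c :=
          killedRegionGreen_mono_set hWfin Set.inter_subset_right z c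
      _ ≤ killedRegionGreen (zdGraph 2) (mW c k) z c := killedRegionGreen_mono_graph hGle (mW c k) z c
      _ ≤ C₁ := hC c k hk z hz2
  have h3 : M * edgeSurvive Gr (mW c k) z ≤ M * (1 - maneuverConst) := mul_le_mul_of_nonneg_left h1 hM0
  linarith

/-- **`G_Λ(·, c) ≤ C₁ / c_*` off the pole box** (Chelkak 2016, Lemma 2.15, for the edge-killed walk
of a Jordan domain). If the free Green function of `mW c k` with pole `c` is `≤ C₁` off the box of
radius `12k - 2` about `c` (all `c`, `k ≥ 1`), then for every Jordan domain `D`, mesh `δ > 0`,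
boundary point `p ∈ ∂D` in the open box of radius `12k` about `c`, and finite region `Λ`, the Green
function of the edge-killed walk `discreteDomainGraph D δ` in `Λ` with pole `c` is `≤ C₁ / maneuverConst`
off the box of radius `12k - 2`: maximum principle outside the layer `|· - c|_∞ = 12k - 1`, one-box
step on the layer, and `M ≤ C₁ + (1 - c_*) M` at a maximiser. [cite: Chelkak2016, Lemma 2.15] -/
theorem killedRegionGreen_le_of_frontier_mem_box :
    ∀ (C₁ : ℝ), (∀ (c : Site 2) (k : ℕ), 0 < k → ∀ w : Site 2, w ∉ WeakBeurling.sqBox c (12 * k - 2) →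
      killedRegionGreen (zdGraph 2) (mW c k) w c ≤ C₁) →
    ∀ (D : JordanDomain) (δ : ℝ), 0 < δ → ∀ p ∈ frontier D.carrier, ∀ (c : Site 2) (k : ℕ), 0 < k →
      |p.re / δ - c 0| < 12 * k → |p.im / δ - c 1| < 12 * k →
      ∀ (Λ : Set (Site 2)), Λ.Finite → ∀ w : Site 2, w ∉ WeakBeurling.sqBox c (12 * k - 2) →
        killedRegionGreen (discreteDomainGraph D.carrier δ) Λ w c ≤ C₁ / maneuverConst := by
  intro C₁ hC D δ hδ p hp c k hk hp0 hp1 Λ hΛ w hw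
  have hC₁ : 0 ≤ C₁ := (killedRegionGreen_nonneg _ _ _).trans (hC c k hk w hw)
  have hc0 : 0 < maneuverConst := maneuverConst_pos
  have hquot : 0 ≤ C₁ / maneuverConst := div_nonneg hC₁ hc0.le
  by_cases hcΛ : c ∈ Λ
  swap
  · rw [killedRegionGreen_of_not_mem_right Λ w hcΛ]
    exact hquot
  have hn : (0 : ℤ) ≤ 12 * k - 2 := by omega
  -- the layer `|z - c|_∞ = 12k - 1` inside `Λ`
  have hLfin : {z | z ∈ Λ ∧ z ∉ sqBox c (12 * k - 2) ∧ z ∈ sqBox c (12 * k - 2 + 1)}.Finite :=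
    hΛ.subset fun z hz => hz.1
  rcases Set.eq_empty_or_nonempty {z | z ∈ Λ ∧ z ∉ sqBox c (12 * k - 2) ∧ z ∈ sqBox c (12 * k - 2 + 1)}
    with hL | hL
  · -- empty layer: `G = 0` off the box
    have ha := greenSC_le_of_layer_le (Gr := discreteDomainGraph D.carrier δ) hΛ c hn le_rfl
      (fun z hz h1 h2 => by
        have : z ∈ ({z | z ∈ Λ ∧ z ∉ sqBox c (12 * k - 2) ∧ z ∈ sqBox c (12 * k - 2 + 1)} : Set (Site 2)) :=
          ⟨hz, h1, h2⟩
        rw [hL] at this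
        exact absurd this (Set.notMem_empty z)) w hw
    exact ha.trans hquot
  · obtain ⟨z₀, hz₀, hmax⟩ := Set.exists_max_image _
      (fun z => killedRegionGreen (discreteDomainGraph D.carrier δ) Λ z c) hLfin hL
    obtain ⟨hz₀Λ, hz₀2, hz₀1⟩ := hz₀
    have hM0 : 0 ≤ killedRegionGreen (discreteDomainGraph D.carrier δ) Λ z₀ c := killedRegionGreen_nonneg _ _ _
    -- (a) the maximum on the layer bounds `G` off the box
    have ha := greenSC_le_of_layer_le (Gr := discreteDomainGraph D.carrier δ) hΛ c hn hM0
      (fun z hz h1 h2 => hmax z ⟨hz, h1, h2⟩)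
    -- (b) the one-box step at the maximiser
    have hz₀B : z₀ ∈ mB c k := by
      rw [mB_eq_sqBox]
      exact sqBox_mono c (by omega) hz₀1
    have hb := greenSC_layer_le C₁ hC D hδ hp hk hp0 hp1 hΛ hcΛ hM0 ha z₀ hz₀Λ hz₀B hz₀2
    -- (c) `M ≤ C₁ + (1 - c_*) M` gives `M ≤ C₁ / c_*`
    have hM : killedRegionGreen (discreteDomainGraph D.carrier δ) Λ z₀ c ≤ C₁ / maneuverConst := by
      rw [le_div_iff₀ hc0]
      nlinarith
    exact (ha w hw).trans hM

end Summit.CriticalPhenomena.SAWScalingLimit.Theorems.AvoidanceLimit.Anchor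

end
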